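import Literature.NumberTheory.Automorphic.GL2CESHAssembly
import HarnessLib

/-!
# `bianchi_cuspidal_regularLAlgebraic_eigenclassExists` holds

Topic `Literature/NumberTheory/Automorphic`. Discharge (theorem only, no definition, no named fact) of
the named fact `bianchi_cuspidal_regularLAlgebraic_eigenclassExists` of `BianchiCuspidalEigenclass`
(Scholze 2015, §V.4, the input to Cor. V.4.2: a regular L-algebraic cuspidal `π` of `GL₂` over an
imaginary quadratic `F` contributes a Hecke eigenclass to `H^*(X_K, M_{ξ,ℂ})`).  The sibling
`BianchiCuspidalEigenclassProofs` is imported by the reduction chain used here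
(`BianchiCuspidalEigenclassOfComparison` → `…OfResGLn` → `…OfClean`), so the discharge lives in this
second sibling.

The proof is the tree's reduction `bianchi_cuspidal_regularLAlgebraic_eigenclassExists_of_cleanResGLTwo'`
(contragredient and `|det|^{1/2}`-twist to a clean cohomological `π`, Clozel's purity and
algebraicity lemmas, `S`-good levels) fed with the Eichler–Shimura–Harder eigenclass of a clean
Bianchi cusp form, `GL2CESH.cleanResGLTwo_eigenclass` (`GL2CESHAssembly`): the van Est class in
`H¹(S_{K_f(𝔫)}, E_λ(ℂ))` of the closed `E_λ(ℂ)`-valued `1`-forms on `GL₂(ℂ)` attached to the lowest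
`K`-type of `π` (Harder 1987, §3), non-zero by Kuga's lemma and Borel's integration by parts
(`GL2CESHNonvanishing`), and Hecke-equivariant by Flath's theorem (`GL2CESHHecke`).
[cite: Scholze2015, §V.4, Cor. V.4.2] [cite: Harder1987, §3] [cite: BorelWallach2000, VII §2]
-/

noncomputable section

namespace Literature.NumberTheory.Automorphic

open _root_.NumberField

/-- **Scholze 2015, §V.4 (input to Cor. V.4.2) / Harder 1987, §3: the named fact
`bianchi_cuspidal_regularLAlgebraic_eigenclassExists` holds.** [cite: Scholze2015, §V.4, Cor. V.4.2]
[cite: Harder1987, §3] -/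
theorem bianchi_cuspidal_regularLAlgebraic_eigenclassExists_holds :
    bianchi_cuspidal_regularLAlgebraic_eigenclassExists :=
  bianchi_cuspidal_regularLAlgebraic_eigenclassExists_of_cleanResGLTwo'
    fun K _ _ htc h2 hcpt 𝔫 lam h𝔫 hdom π hW' _ _ T hT hTa φ hφW hφ0 hfix =>
      GL2CESH.cleanResGLTwo_eigenclass K htc h2 hcpt 𝔫 lam h𝔫 hdom π hW' T hT hTa φ hφW hφ0 hfix

end Literature.NumberTheory.Automorphic

end
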